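import Summits.NavierStokesRegularity.NavierStokesRegularity.Theorems.NoOverheating.Negative.ExcludedStrataCensusV2
import Summits.NavierStokesRegularity.NavierStokesRegularity.Theorems.NoOverheating.Negative.HiddenRSSUnboundedSpeedsExcluded
import Summits.NavierStokesRegularity.NavierStokesRegularity.Theorems.NoOverheating.Negative.L3SliceWindowsExcluded
import Summits.NavierStokesRegularity.NavierStokesRegularity.Theorems.NoOverheating.Negative.LargeScaleNullTailWindowsExcluded

/-!
# KJ-45 — CENSUS v3 of the excluded strata of route `AngularGalerkinLadder`'s window sequences
# ((S0)–(S5) of `excludedStrata_windowSequences_v2` + (S6) off-band hidden rotated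
# self-similarity + (S7) `L³`- or energy-bounded slices + (S8) uniformly null tails)

Refuter lineage, Negative lane of crux K2 `NoOverheating` (supports, does not decide).  This file
proves NOTHING new about fluids: it folds three further kernel rows into the one census statement
of record, so that planners, tribunal and census cite ONE decl, `excludedStrata_windowSequences_v3`,
for "what an admissible window sequence of K2 can NOT be":

* (S6) hidden ROTATED self-similarity about axes `gₙe₃` — `(μ, gₙR_{2αₙ log μ}gₙ⁻¹)`-RDSS for every
  `μ > 1` — with speeds OFF Pineau–Vicol's open middle band, `|αₙ| ≤ β₁(C₀) ∨ β₂(C₀) ≤ |αₙ|` at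
  every index (`no_windowSequence_hiddenRSS_offBand`: KJ-40 `HiddenRSSWindowsExcluded`, Pineau–Vicol
  2026 Thm 1.7 (i)–(ii), and KJ-42 `HiddenRSSUnboundedSpeedsExcluded`, KNSS 2009 Thm 5.3 for
  unbounded speeds);
* (S7) the integrability corner: slices `uₙ(−1)` bounded in `L³(ℝ³)` (S7a) or in energy `L²(ℝ³)`
  (S7b) uniformly in `n` (`no_windowSequence_L3slice` / `no_windowSequence_L2slice`, KJ-43
  `L3SliceWindowsExcluded`, Albritton–Barker 2019 Thm 1.2);
* (S8) the tail corner: slices `uₙ(−1)` that are `o(1/|x|)` at infinity uniformly in `n`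
  (`no_windowSequence_nullTail`, KJ-44 `LargeScaleNullTailWindowsExcluded`, Albritton–Barker 2019
  Thm 4.1).

(S0)–(S6) are ANY-window or threshold strata on the SYMMETRY of the profiles; (S7)–(S8) pin their
FAR FIELD: Type I makes the slices `O(C₀/|y|)`, and the tail germ `|y| uₙ(−1, y)` can neither be
summable in `L³`/`L²` nor uniformly small.  WHAT ESCAPES every row: `C₀ > ε₀`, genuinely discrete
RDSS whose usable powers twist in Pineau–Vicol's open middle range (or meet only coarse windows),
no hidden factor below `λ₁(C₀)`, hidden continuous rotation (if any) with speeds eventually inside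
`(β₁, β₂)`, and slices with a non-degenerate degree-`−1` tail germ.  WHAT THIS IS NOT: not
`¬NoOverheating`; no new Literature fact, no definition; standard axioms only.
[cite: KochNadirashviliSereginSverak2009, Theorems 1.2–1.3 and 5.3]
[cite: ChaeWolf2017RemovingDSS, Theorem 1.3 (arXiv:1610.09464 p. 3)]
[cite: PineauVicol2026, Theorem 1.7 (i)–(ii) (arXiv:2607.09619 p. 7)]
[cite: AlbrittonBarker2019, Theorems 1.2 and 4.1 (arXiv:1811.00502 pp. 4, 9)] -/

namespace Summit.NavierStokesRegularity.AngularGalerkinLadderExcludedStrataCensusV3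

open Set Filter MeasureTheory Topology Function
open scoped ENNReal
open Literature.Analysis Literature.Analysis.FluidPDE
open Summit.NavierStokesRegularity.FluidComputer
open Summit.NavierStokesRegularity.NavierStokesRegularity.Theses.AngularGalerkinLadder
open Summit.NavierStokesRegularity.AngularGalerkinLadderExcludedStrataCensusV2
open Summit.NavierStokesRegularity.AngularGalerkinLadderHiddenRSSUnboundedSpeedsExcluded
open Summit.NavierStokesRegularity.AngularGalerkinLadderL3SliceWindowsExcluded
open Summit.NavierStokesRegularity.AngularGalerkinLadderLargeScaleNullTailWindowsExcluded

/-- **Census theorem v3: the excluded strata (S0)–(S8) of K2's window sequences.**  As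
`excludedStrata_windowSequences_v2`, plus: (S6) hidden rotated self-similarity about axes `gₙe₃`
for every factor `μ > 1` with speeds off the band, `|αₙ| ≤ β₁ ∨ β₂ ≤ |αₙ|`
(`no_windowSequence_hiddenRSS_offBand`); (S7a) `‖uₙ(−1)‖_{L³} ≤ M < ∞`, (S7b)
`‖uₙ(−1)‖_{L²} ≤ M < ∞` (`no_windowSequence_L3slice`, `no_windowSequence_L2slice`); (S8) uniformly
null tails, `∀ η > 0 ∃ ρ ∀ n ∀ ‖x‖ ≥ ρ, ‖x‖‖uₙ(−1, x)‖ ≤ η` (`no_windowSequence_nullTail`) — all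
for ANY window `1 < cmin ≤ cmax` and ANY rotations.
[cite: PineauVicol2026, Theorem 1.7 (i)–(ii)] [cite: KochNadirashviliSereginSverak2009, Theorem 5.3]
[cite: AlbrittonBarker2019, Theorems 1.2 and 4.1] -/
theorem excludedStrata_windowSequences_v3 :
    ∃ ε₀ : ℝ, 0 < ε₀ ∧ ∀ C₀ : ℝ, ∃ κ α₁ c₁ α₂ c₂ lam₁ β₁ β₂ : ℝ,
      1 < κ ∧ 0 < α₁ ∧ 1 < c₁ ∧ 0 < α₂ ∧ 1 < c₂ ∧ 1 < lam₁ ∧ 0 < β₁ ∧ 0 < β₂ ∧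
      ∀ {cmin cmax δ : ℝ} {L : ℕ → ℕ} {ε c : ℕ → ℝ}
        {R : ℕ → (EuclideanSpace ℝ (Fin 3) ≃ₗᵢ[ℝ] EuclideanSpace ℝ (Fin 3))}
        {u : ℕ → ℝ → EuclideanSpace ℝ (Fin 3) → EuclideanSpace ℝ (Fin 3)}
        {p : ℕ → ℝ → EuclideanSpace ℝ (Fin 3) → ℝ}
        {d : ℕ → ℝ → EuclideanSpace ℝ (Fin 3) → EuclideanSpace ℝ (Fin 3)},
        1 < cmin → 0 < δ → Tendsto ε atTop (𝓝 0) →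
        (∀ n, AngularLadder.IsWindowProfile (L n) C₀ cmin cmax δ (ε n) (c n) (R n) (u n) (p n)
          (d n)) →
        ¬ (C₀ ≤ ε₀ ∨
           (∀ n, ∀ t < 0, IsAxisymmetric (u n t)) ∨
           (∃ q : ℕ, 0 < q ∧ cmax ^ q < κ ∧
              ∀ x, Tendsto (fun n => ((R n) ^ q) x) atTop (𝓝 x)) ∨
           (∃ (q : ℕ) (g : ℕ → (EuclideanSpace ℝ (Fin 3) ≃ₗᵢ[ℝ] EuclideanSpace ℝ (Fin 3)))
              (θ : ℕ → ℝ),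
              0 < q ∧ cmax ^ q < c₁ ∧ (∀ n x, ((R n) ^ q) x = g n (rotZ (θ n) ((g n).symm x))) ∧
              ∀ n, |θ n| ≤ 2 * α₁ * (q * Real.log (c n))) ∨
           (∃ (Θ ℓ : ℝ) (g : ℕ → (EuclideanSpace ℝ (Fin 3) ≃ₗᵢ[ℝ] EuclideanSpace ℝ (Fin 3)))
              (θ : ℕ → ℝ),
              ℓ < Real.log c₂ ∧ (∀ n x, R n x = g n (rotZ (θ n) ((g n).symm x))) ∧
              (∀ n, |θ n| ≤ Θ) ∧ (∀ n, 2 * α₂ * Real.log (c n) ≤ |θ n|) ∧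
              ∀ n, (1 + (θ n / (2 * Real.log (c n))) ^ 2) * Real.log (c n) ≤ ℓ) ∨
           (∃ lam : ℝ, 1 < lam ∧ lam < lam₁ ∧ ∀ n, IsDiscretelySelfSimilar lam (u n)) ∨
           (∀ n, IsSelfSimilar (u n)) ∨
           (∃ (g : ℕ → (EuclideanSpace ℝ (Fin 3) ≃ₗᵢ[ℝ] EuclideanSpace ℝ (Fin 3))) (α : ℕ → ℝ),
              (∀ n (μ : ℝ), 1 < μ → IsRotatedDSS μ
                (((g n).symm.trans (rotZLIE (2 * α n * Real.log μ))).trans (g n)) (u n)) ∧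
              ∀ n, |α n| ≤ β₁ ∨ β₂ ≤ |α n|) ∨
           (∃ M : ℝ≥0∞, M < ⊤ ∧ ∀ n, eLpNorm (u n (-1)) 3 volume ≤ M) ∨
           (∃ M : ℝ≥0∞, M < ⊤ ∧ ∀ n, eLpNorm (u n (-1)) 2 volume ≤ M) ∨
           (∀ η : ℝ, 0 < η → ∃ ρ : ℝ, ∀ n x, ρ ≤ ‖x‖ → ‖x‖ * ‖u n (-1) x‖ ≤ η)) := by
  obtain ⟨ε₀, hε₀, H⟩ := excludedStrata_windowSequences_v2
  refine ⟨ε₀, hε₀, fun C₀ => ?_⟩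
  obtain ⟨κ, α₁, c₁, α₂, c₂, lam₁, hκ, hα₁, hc₁, hα₂, hc₂, hlam₁, HC⟩ := H C₀
  obtain ⟨β₁, β₂, hβ₁, hβ₂, H6⟩ := no_windowSequence_hiddenRSS_offBand C₀
  refine ⟨κ, α₁, c₁, α₂, c₂, lam₁, β₁, β₂, hκ, hα₁, hc₁, hα₂, hc₂, hlam₁, hβ₁, hβ₂,
    fun {cmin cmax δ L ε c R u p d} hcmin hδ hε hW => ?_⟩
  rintro (h0 | h1 | h2 | h3 | h4 | h5 | h5' | ⟨g, α, hRSS, hoff⟩ | ⟨M, hM, hL3⟩ | ⟨M, hM, hL2⟩ |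
    h8)
  · exact HC hcmin hδ hε hW (Or.inl h0)
  · exact HC hcmin hδ hε hW (Or.inr (Or.inl h1))
  · exact HC hcmin hδ hε hW (Or.inr (Or.inr (Or.inl h2)))
  · exact HC hcmin hδ hε hW (Or.inr (Or.inr (Or.inr (Or.inl h3))))
  · exact HC hcmin hδ hε hW (Or.inr (Or.inr (Or.inr (Or.inr (Or.inl h4)))))
  · exact HC hcmin hδ hε hW (Or.inr (Or.inr (Or.inr (Or.inr (Or.inr (Or.inl h5))))))
  · exact HC hcmin hδ hε hW (Or.inr (Or.inr (Or.inr (Or.inr (Or.inr (Or.inr h5'))))))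
  · exact H6 hδ hε hW hRSS hoff
  · exact no_windowSequence_L3slice hcmin hδ hε hW hM hL3
  · exact no_windowSequence_L2slice hcmin hδ hε hW hM hL2
  · exact no_windowSequence_nullTail hcmin hδ hε hW h8

/-- **The census, read on the cruxes (v3).**  `RungBlowupCofinal` together with a `NoOverheating`
whose window profiles fall, rung by rung from some rung on, into ONE FIXED excluded stratum among
(S7a) `‖u(−1)‖₃ ≤ M`, (S7b) `‖u(−1)‖₂ ≤ M`, (S8) one tail modulus `ρ`, is contradictory — the
sequence-level strata (S0)–(S6) are read on the cruxes in their own files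
(`not_cofinal_and_noOverheating_*`). [cite: AlbrittonBarker2019, Theorems 1.2 and 4.1] -/
theorem not_cofinal_and_noOverheating_farField (C₀ : ℝ) :
    ¬ (RungBlowupCofinal ∧
      ∃ (cmin cmax δ : ℝ) (L₀ : ℕ) (ε : ℕ → ℝ) (M : ℝ≥0∞) (ρ : ℝ → ℝ), 1 < cmin ∧ 0 < δ ∧
        M < ⊤ ∧ Tendsto ε atTop (𝓝 0) ∧
        ∀ L ≥ L₀, AngularLadder.RungIsSingular L →
          ∃ (c : ℝ) (R : EuclideanSpace ℝ (Fin 3) ≃ₗᵢ[ℝ] EuclideanSpace ℝ (Fin 3))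
            (u : ℝ → EuclideanSpace ℝ (Fin 3) → EuclideanSpace ℝ (Fin 3))
            (p : ℝ → EuclideanSpace ℝ (Fin 3) → ℝ)
            (d : ℝ → EuclideanSpace ℝ (Fin 3) → EuclideanSpace ℝ (Fin 3)),
            AngularLadder.IsWindowProfile L C₀ cmin cmax δ (ε L) c R u p d ∧
              (eLpNorm (u (-1)) 3 volume ≤ M ∨ eLpNorm (u (-1)) 2 volume ≤ M ∨
                ∀ η : ℝ, 0 < η → ∀ x, ρ η ≤ ‖x‖ → ‖x‖ * ‖u (-1) x‖ ≤ η)) := by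
  rintro ⟨h₁, cmin, cmax, δ, L₀, ε, M, ρ, hcmin, hδ, hM, hε, hwin⟩
  choose L hLge hLsing using fun n : ℕ => h₁ (max L₀ n)
  choose c R u p d hW hstr using fun n : ℕ =>
    hwin (L n) (le_trans (le_max_left _ _) (hLge n)) (hLsing n)
  have hLmono : Tendsto L atTop atTop :=
    tendsto_atTop_mono (fun n => le_trans (le_max_right _ _) (hLge n)) tendsto_id
  have hε' : Tendsto (fun n : ℕ => ε (L n)) atTop (𝓝 0) := hε.comp hLmono
  -- one of the three strata is met frequently; pass to that subsequence
  by_cases h3 : ∃ᶠ n in atTop, eLpNorm (u n (-1)) 3 volume ≤ M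
  · obtain ⟨φ, hφ, hφ3⟩ := extraction_of_frequently_atTop h3
    exact no_windowSequence_L3slice (L := fun n => L (φ n)) hcmin hδ (hε'.comp hφ.tendsto_atTop)
      (fun n => hW (φ n)) hM hφ3
  by_cases h2 : ∃ᶠ n in atTop, eLpNorm (u n (-1)) 2 volume ≤ M
  · obtain ⟨φ, hφ, hφ2⟩ := extraction_of_frequently_atTop h2
    exact no_windowSequence_L2slice (L := fun n => L (φ n)) hcmin hδ (hε'.comp hφ.tendsto_atTop)
      (fun n => hW (φ n)) hM hφ2
  have h8 : ∃ᶠ n in atTop, ∀ η : ℝ, 0 < η → ∀ x, ρ η ≤ ‖x‖ → ‖x‖ * ‖u n (-1) x‖ ≤ η := by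
    refine ((not_frequently.1 h3).and (not_frequently.1 h2)).frequently.mono fun n hn => ?_
    exact ((hstr n).resolve_left hn.1).resolve_left hn.2
  obtain ⟨φ, hφ, hφ8⟩ := extraction_of_frequently_atTop h8
  exact no_windowSequence_nullTail (L := fun n => L (φ n)) hcmin hδ (hε'.comp hφ.tendsto_atTop)
    (fun n => hW (φ n)) fun η hη => ⟨ρ η, fun n x hx => hφ8 n η hη x hx⟩

end Summit.NavierStokesRegularity.AngularGalerkinLadderExcludedStrataCensusV3
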